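import Literature.MathematicalPhysics.KineticTheory.PureQuarticSDE
import Literature.MathematicalPhysics.KineticTheory.LangevinChainKernel
import Literature.MathematicalPhysics.KineticTheory.LangevinChainFlowBounds
import HarnessLib

/-!
# The purely quartic chain: transition kernels, energy bounds along the flow, noise continuity

Topic `Literature/MathematicalPhysics/KineticTheory`. Third layer of the proof of the named fact
`CuneoEckmannHairerReyBellet2018_thm213_pureQuartic` (`PureQuarticChainNESS.lean`; CEHR 2018,
Thm 2.13, for `pureQuarticChain μ γ = ⟨μq⁴/4, r⁴/4, γ⟩`, `μ > 0`, `γ ≥ 0`): the files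
`LangevinChainKernel.lean` (transition kernels `P_t(x,·) = law(Φ_t(x,B))` of the SDE (2.2):
Markov, measurable, `P_0 = id`, Feller, Chapman–Kolmogorov), `LangevinChainFlowBounds.lean`
(two-sided exponential energy bounds along the flow, local increment bounds, the far region) and
`LangevinChainNoiseContinuity.lean` (Lipschitz dependence of the flow on the noise path), written in
the tree for `pinnedChain ω₂ lam β γ`, RE-INSTANTIATED VERBATIM for the purely quartic chain. The
generic objects (`chainNoise`, `OscillatorChain.solMap`, `OscillatorChain.transitionKernel`, the
momentum-perturbation identities) are imported from those files; the chain-specific inputs are the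
pathwise solution theory of `PureQuarticSDE.lean` and the energy layer `PureQuarticEnergy.lean`.

## References

* N. Cuneo, J.-P. Eckmann, M. Hairer, L. Rey-Bellet, EJP 23 (2018) no. 55 (arXiv:1712.09413):
  §2 eq. (2.2), (2.3), §3 p. 7 (strong solutions, Markov property), p. 9 ("the process is Feller"),
  §3 eq. (3.3).
* D. Revuz, M. Yor, *Continuous Martingales and Brownian Motion* (3rd ed., 1999), Ch. III §1,
  Ch. IX §1.
-/

noncomputable section

open MeasureTheory ProbabilityTheory Filter Topology Set Metric
open scoped NNReal ENNReal

namespace Literature.MathematicalPhysics.KineticTheory.HeatConduction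

open Literature.Probability.Process OscillatorChain

variable {N : ℕ}

/-! ### The purely quartic chain: measurability and continuity of the solution map -/

section PureQuartic

variable {μ γ : ℝ} (hμ : 0 < μ) (hγ : 0 ≤ γ) (N : ℕ)
  (T_L T_R : ℝ)
include hμ hγ

/-- The solution map is jointly measurable in `(x, w)` (parametric measurability of the flow,
`pureQuarticChain_measurable_chainFlow`, the noise being continuous in time for EVERY pair of raw
paths). [folklore] -/
theorem pureQuarticChain_measurable_solMap (t : ℝ) :
    Measurable fun p : PhaseSpace N × WienerPair => (pureQuarticChain μ γ).solMap N T_L T_R t p.1 p.2 := by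
  unfold OscillatorChain.solMap
  exact pureQuarticChain_measurable_chainFlow hμ hγ N (X := fun p : PhaseSpace N × WienerPair => p.1)
    (G := fun p : PhaseSpace N × WienerPair => chainNoise N (Real.sqrt (2 * (pureQuarticChain μ γ).γ * T_L))
      (Real.sqrt (2 * (pureQuarticChain μ γ).γ * T_R)) p.2)
    measurable_fst (fun p => continuous_chainNoise _ _ p.2)
    (fun u => (measurable_chainNoise _ _ u).comp measurable_snd) t

/-- The solution map driven by the Brownian pair is jointly measurable in `(x, ω)`. [folklore] -/
theorem pureQuarticChain_measurable_solMap_pairPath (t : ℝ) :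
    Measurable fun p : PhaseSpace N × WienerPair =>
      (pureQuarticChain μ γ).solMap N T_L T_R t p.1 (pairPath p.2) := by
  -- NB: elaborating `Measurable.comp` AGAINST the expected type makes the unifier unfold
  -- `solMap`/`chainFlow` (time-out); build the term first, then `exact`.
  have h2 : Measurable fun p : PhaseSpace N × WienerPair => (p.1, pairPath p.2) :=
    measurable_fst.prodMk (measurable_pairPath.comp measurable_snd)
  have h := (pureQuarticChain_measurable_solMap hμ hγ N T_L T_R t).comp h2
  exact h

/-- For fixed `x`, `ω ↦ Φ_t(x, pairPath ω)` is measurable. [folklore] -/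
theorem pureQuarticChain_measurable_solMap_pairPath_right (t : ℝ) (x : PhaseSpace N) :
    Measurable fun ω : WienerPair => (pureQuarticChain μ γ).solMap N T_L T_R t x (pairPath ω) := by
  have h := (pureQuarticChain_measurable_solMap_pairPath hμ hγ N T_L T_R t).comp
    (measurable_prodMk_left (x := x))
  exact h

/-- The solution map is continuous in time. [folklore] -/
theorem pureQuarticChain_continuous_solMap (x : PhaseSpace N) (w : WienerPair) :
    Continuous fun t => (pureQuarticChain μ γ).solMap N T_L T_R t x w := by
  unfold OscillatorChain.solMap
  exact pureQuarticChain_continuous_chainFlow hμ hγ N x (continuous_chainNoise _ _ w)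

/-- The solution map is continuous in the initial condition. [folklore] -/
theorem pureQuarticChain_continuous_solMap_left (t : ℝ) (w : WienerPair) :
    Continuous fun x => (pureQuarticChain μ γ).solMap N T_L T_R t x w := by
  unfold OscillatorChain.solMap
  exact pureQuarticChain_continuous_chainFlow_left hμ hγ N (continuous_chainNoise _ _ w) t

/-- The solution map is jointly measurable in `(t, x, w)` (continuous in `t`, measurable in
`(x, w)`). [folklore] -/
theorem pureQuarticChain_measurable_uncurry_solMap :
    Measurable fun p : ℝ × (PhaseSpace N × WienerPair) =>
      (pureQuarticChain μ γ).solMap N T_L T_R p.1 p.2.1 p.2.2 := by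
  have h := measurable_uncurry_of_continuous_of_measurable
    (u := fun (t : ℝ) (p : PhaseSpace N × WienerPair) => (pureQuarticChain μ γ).solMap N T_L T_R t p.1 p.2)
    (fun p => pureQuarticChain_continuous_solMap hμ hγ N T_L T_R p.1 p.2)
    (pureQuarticChain_measurable_solMap hμ hγ N T_L T_R)
  exact h

omit hμ hγ in
/-- At time `0` (and before) the solution map is the initial condition: `Φ_t(x, w) = x` for
`t ≤ 0` (the noise vanishes at `0`). [folklore] -/
theorem pureQuarticChain_solMap_of_nonpos (x : PhaseSpace N) (w : WienerPair) {t : ℝ} (ht : t ≤ 0) :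
    (pureQuarticChain μ γ).solMap N T_L T_R t x w = x := by
  unfold OscillatorChain.solMap
  rw [pureQuarticChain_chainFlow_of_nonpos μ γ N x (continuous_chainNoise _ _ w) ht, chainNoise_zero]
  simp

/-- **The cocycle property through the shift of the Brownian pair**: for `s, t ≥ 0`,
`Φ_{s+t}(x, B(ω)) = Φ_t(Φ_s(x, B(ω)), θ_s ω)` with `θ_s ω = pairShift s ω` the pair of shifted
paths (`pureQuarticChain_chainFlow_add` + `chainNoise_pairShift`). [folklore] -/
theorem pureQuarticChain_solMap_add_pairPath (s : ℝ≥0) {t : ℝ} (ht : 0 ≤ t) (x : PhaseSpace N) (ω : WienerPair) :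
    (pureQuarticChain μ γ).solMap N T_L T_R (s + t) x (pairPath ω) =
      (pureQuarticChain μ γ).solMap N T_L T_R t
        ((pureQuarticChain μ γ).solMap N T_L T_R s x (pairPath ω)) (pairShift s ω) := by
  unfold OscillatorChain.solMap
  rw [pureQuarticChain_chainFlow_add hμ hγ N x (continuous_chainNoise _ _ _) s.coe_nonneg ht]
  refine pureQuarticChain_chainFlow_congr hμ hγ N _ ?_ (continuous_chainNoise _ _ _)
    (fun r hr => (chainNoise_pairShift _ _ s ω hr.1).symm) ⟨ht, le_rfl⟩
  exact ((continuous_chainNoise _ _ _).comp (continuous_const_add _)).sub continuous_const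

end PureQuartic


/-! ### The transition kernels of the purely quartic chain -/

section PureQuarticKernel

variable {μ γ : ℝ} (hμ : 0 < μ) (hγ : 0 ≤ γ) (N : ℕ)
  (T_L T_R : ℝ)
include hμ hγ

/-- **The transition kernel of the purely quartic chain is the law of the solution map driven by the
Brownian pair**: `P_t(x, ·) = law(Φ_t(x, B))` (no junk). [cite: CuneoEckmannHairerReyBellet2018, eq. (2.3)] -/
theorem pureQuarticChain_transitionKernel_apply (t : ℝ≥0) (x : PhaseSpace N) :
    (pureQuarticChain μ γ).transitionKernel N T_L T_R t x =
      wienerPair.map fun ω => (pureQuarticChain μ γ).solMap N T_L T_R t x (pairPath ω) := by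
  rw [OscillatorChain.transitionKernel,
    dif_pos (pureQuarticChain_measurable_solMap_pairPath hμ hγ N T_L T_R t)]
  rfl

/-- `P_t(x, A) = P{Φ_t(x, B) ∈ A}`. [cite: CuneoEckmannHairerReyBellet2018, eq. (2.3)] -/
theorem pureQuarticChain_transitionKernel_apply' (t : ℝ≥0) (x : PhaseSpace N) {A : Set (PhaseSpace N)}
    (hA : MeasurableSet A) :
    (pureQuarticChain μ γ).transitionKernel N T_L T_R t x A =
      wienerPair ((fun ω => (pureQuarticChain μ γ).solMap N T_L T_R t x (pairPath ω)) ⁻¹' A) := by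
  rw [pureQuarticChain_transitionKernel_apply hμ hγ,
    Measure.map_apply (pureQuarticChain_measurable_solMap_pairPath_right hμ hγ N T_L T_R t x) hA]

/-- `P^t g(x) = E g(Φ_t(x, B))` for measurable `g ≥ 0` (Lebesgue integral).
[cite: CuneoEckmannHairerReyBellet2018, §3 p. 7] -/
theorem pureQuarticChain_lintegral_transitionKernel (t : ℝ≥0) (x : PhaseSpace N) {g : PhaseSpace N → ℝ≥0∞}
    (hg : Measurable g) :
    ∫⁻ y, g y ∂((pureQuarticChain μ γ).transitionKernel N T_L T_R t x) =
      ∫⁻ ω, g ((pureQuarticChain μ γ).solMap N T_L T_R t x (pairPath ω)) ∂wienerPair := by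
  rw [pureQuarticChain_transitionKernel_apply hμ hγ,
    lintegral_map hg (pureQuarticChain_measurable_solMap_pairPath_right hμ hγ N T_L T_R t x)]

/-- `P^t g(x) = E g(Φ_t(x, B))` for (ae-strongly) measurable real `g` (Bochner integral; both sides
are junk `0` together when `g ∘ Φ_t(x, B)` is not integrable).
[cite: CuneoEckmannHairerReyBellet2018, §3 p. 7] -/
theorem pureQuarticChain_integral_transitionKernel (t : ℝ≥0) (x : PhaseSpace N) {g : PhaseSpace N → ℝ}
    (hg : AEStronglyMeasurable g ((pureQuarticChain μ γ).transitionKernel N T_L T_R t x)) :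
    ∫ y, g y ∂((pureQuarticChain μ γ).transitionKernel N T_L T_R t x) =
      ∫ ω, g ((pureQuarticChain μ γ).solMap N T_L T_R t x (pairPath ω)) ∂wienerPair := by
  rw [pureQuarticChain_transitionKernel_apply hμ hγ] at hg ⊢
  rw [integral_map (pureQuarticChain_measurable_solMap_pairPath_right hμ hγ N T_L T_R t x).aemeasurable hg]

/-- The transition kernels are Markov (probability) kernels: no explosion.
[cite: CuneoEckmannHairerReyBellet2018, §3 p. 7] -/
theorem pureQuarticChain_isMarkovKernel_transitionKernel (t : ℝ≥0) :
    IsMarkovKernel ((pureQuarticChain μ γ).transitionKernel N T_L T_R t) := by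
  refine ⟨fun x => ?_⟩
  rw [pureQuarticChain_transitionKernel_apply hμ hγ]
  exact Measure.isProbabilityMeasure_map
    (pureQuarticChain_measurable_solMap_pairPath_right hμ hγ N T_L T_R t x).aemeasurable

/-- The law of `Φ_t(x, ·)` under `wienerPair` in RAW path coordinates is the same kernel (the pair of
Brownian paths has law `wienerPair`, `map_pairPath_wienerPair`). [folklore] -/
theorem pureQuarticChain_transitionKernel_eq_map_solMap (t : ℝ≥0) (x : PhaseSpace N) :
    (pureQuarticChain μ γ).transitionKernel N T_L T_R t x =
      wienerPair.map ((pureQuarticChain μ γ).solMap N T_L T_R t x) := by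
  have h1 : Measurable ((pureQuarticChain μ γ).solMap N T_L T_R t x) := by
    have h := (pureQuarticChain_measurable_solMap hμ hγ N T_L T_R t).comp
      (measurable_prodMk_left (x := x))
    exact h
  rw [pureQuarticChain_transitionKernel_apply hμ hγ]
  change Measure.map ((pureQuarticChain μ γ).solMap N T_L T_R t x ∘ pairPath) wienerPair = _
  rw [← Measure.map_map h1 measurable_pairPath, map_pairPath_wienerPair]

/-- **Joint measurability** of `(t, x) ↦ P_t(x, ·)` (the solution map is jointly measurable in
`(t, x, ω)`): the transition kernels form a measurable Markov semigroup. [folklore] -/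
theorem pureQuarticChain_measurable_transitionKernel :
    Measurable fun p : ℝ≥0 × PhaseSpace N => (pureQuarticChain μ γ).transitionKernel N T_L T_R p.1 p.2 := by
  set F : (ℝ≥0 × PhaseSpace N) × WienerPair → PhaseSpace N := fun q =>
    (pureQuarticChain μ γ).solMap N T_L T_R q.1.1 q.1.2 (pairPath q.2) with hF
  have hFm : Measurable F := by
    have h1 : Measurable fun q : (ℝ≥0 × PhaseSpace N) × WienerPair =>
        ((q.1.1 : ℝ), (q.1.2, pairPath q.2)) :=
      (measurable_coe_nnreal_real.comp (measurable_fst.comp measurable_fst)).prodMk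
        ((measurable_snd.comp measurable_fst).prodMk (measurable_pairPath.comp measurable_snd))
    have h := (pureQuarticChain_measurable_uncurry_solMap hμ hγ N T_L T_R).comp h1
    exact h
  refine Measure.measurable_of_measurable_coe _ fun A hA => ?_
  have h : (fun p : ℝ≥0 × PhaseSpace N => (pureQuarticChain μ γ).transitionKernel N T_L T_R p.1 p.2 A) =
      fun p => wienerPair (Prod.mk p ⁻¹' (F ⁻¹' A)) := by
    funext p
    rw [pureQuarticChain_transitionKernel_apply' hμ hγ N T_L T_R p.1 p.2 hA]
    rfl
  rw [h]
  exact measurable_measure_prodMk_left (hFm hA)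

/-- `P_0 = id`: `Φ_0(x, B) = x`. [folklore] -/
theorem pureQuarticChain_transitionKernel_zero :
    (pureQuarticChain μ γ).transitionKernel N T_L T_R 0 = Kernel.id := by
  refine Kernel.ext fun x => ?_
  rw [pureQuarticChain_transitionKernel_apply hμ hγ, Kernel.id_apply]
  have h : (fun ω : WienerPair => (pureQuarticChain μ γ).solMap N T_L T_R ((0 : ℝ≥0) : ℝ) x (pairPath ω)) =
      fun _ => x := funext fun ω => pureQuarticChain_solMap_of_nonpos N T_L T_R x _ (by simp)
  rw [h, Measure.map_const, measure_univ, one_smul]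

/-- **The Feller property**: `x ↦ P^t g(x) = E g(Φ_t(x, B))` is continuous for bounded continuous `g`
(continuity of the flow in the initial condition and dominated convergence; CEHR p. 9: "the
process is Feller"). [cite: CuneoEckmannHairerReyBellet2018, §3.3] -/
theorem pureQuarticChain_continuous_integral_transitionKernel (t : ℝ≥0) {g : PhaseSpace N → ℝ}
    (hg : Continuous g) {C : ℝ} (hC : ∀ y, ‖g y‖ ≤ C) :
    Continuous fun x => ∫ y, g y ∂((pureQuarticChain μ γ).transitionKernel N T_L T_R t x) := by
  have h : (fun x => ∫ y, g y ∂((pureQuarticChain μ γ).transitionKernel N T_L T_R t x)) =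
      fun x => ∫ ω, g ((pureQuarticChain μ γ).solMap N T_L T_R t x (pairPath ω)) ∂wienerPair := by
    funext x
    exact pureQuarticChain_integral_transitionKernel hμ hγ N T_L T_R t x
      hg.aestronglyMeasurable
  rw [h]
  refine continuous_of_dominated (bound := fun _ => C) (fun x => ?_) (fun x => ?_)
    (integrable_const C) ?_
  · exact (hg.measurable.comp
      (pureQuarticChain_measurable_solMap_pairPath_right hμ hγ N T_L T_R t x)).aestronglyMeasurable
  · exact Eventually.of_forall fun ω => hC _
  · exact Eventually.of_forall fun ω =>
      hg.comp (pureQuarticChain_continuous_solMap_left hμ hγ N T_L T_R t (pairPath ω))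

/-- The Feller property for `g : PhaseSpace N →ᵇ ℝ`. [cite: CuneoEckmannHairerReyBellet2018, §3.3] -/
theorem pureQuarticChain_continuous_integral_transitionKernel_bcf (t : ℝ≥0) (g : BoundedContinuousFunction (PhaseSpace N) ℝ) :
    Continuous fun x => ∫ y, g y ∂((pureQuarticChain μ γ).transitionKernel N T_L T_R t x) :=
  pureQuarticChain_continuous_integral_transitionKernel hμ hγ N T_L T_R t g.continuous
    (fun y => g.norm_coe_le_norm y)

end PureQuarticKernel


/-! ### The Chapman–Kolmogorov equation -/

section ChapmanKolmogorov

variable {μ γ : ℝ} (hμ : 0 < μ) (hγ : 0 ≤ γ) (N : ℕ)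
  (T_L T_R : ℝ)
include hμ hγ

/-- **The solution at time `s` is measurable with respect to the past of the Brownian pair up to
time `s`** (`σ(pairPast s)`): it is the flow driven by the noise STOPPED at `s`, which is a
continuous path read off `pairPast s ω`, and the flow on `[0, s]` only sees the noise on `[0, s]`.
[folklore] -/
theorem pureQuarticChain_measurable_comap_pairPast_solMap (s : ℝ≥0) (x : PhaseSpace N) :
    Measurable[MeasurableSpace.comap (pairPast s) inferInstance]
      fun ω : WienerPair => (pureQuarticChain μ γ).solMap N T_L T_R s x (pairPath ω) := by
  -- the stopped noise `u ↦ η(min u s)`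
  set G : WienerPair → ℝ → Fin N → ℝ := fun ω u =>
    chainNoise N (Real.sqrt (2 * (pureQuarticChain μ γ).γ * T_L))
      (Real.sqrt (2 * (pureQuarticChain μ γ).γ * T_R)) (pairPath ω) (min u s) with hG
  have hGc : ∀ ω, Continuous (G ω) := fun ω =>
    (continuous_chainNoise _ _ (pairPath ω)).comp (continuous_id.min continuous_const)
  have hGm : ∀ u, Measurable[MeasurableSpace.comap (pairPast s) inferInstance] fun ω => G ω u := by
    intro u
    have hr : (min u (s : ℝ)).toNNReal ∈ Iic s := by
      have h := Real.toNNReal_le_toNNReal (min_le_right u (s : ℝ))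
      rwa [Real.toNNReal_coe] at h
    -- `G ω u = w₀ B_r(ω₁) + w₁ B_r(ω₂)`, `r = (min u s)⁺ ≤ s`, is read off `pairPast s ω`
    set g : (Iic s → ℝ) × (Iic s → ℝ) → Fin N → ℝ := fun q i =>
      (if i.val = 0 then Real.sqrt (2 * (pureQuarticChain μ γ).γ * T_L) else 0) * q.1 ⟨_, hr⟩ +
        (if i.val = N - 1 then Real.sqrt (2 * (pureQuarticChain μ γ).γ * T_R) else 0) * q.2 ⟨_, hr⟩
      with hg
    have hgm : Measurable g := by
      refine measurable_pi_iff.2 fun i => ?_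
      exact (((measurable_pi_apply _).comp measurable_fst).const_mul _).add
        (((measurable_pi_apply _).comp measurable_snd).const_mul _)
    have hfun : (fun ω => G ω u) = g ∘ pairPast s := by
      funext ω i
      simp only [hG, hg, Function.comp_apply, chainNoise_pairPath]
      rfl
    rw [hfun]
    exact hgm.comp (comap_measurable (pairPast s))
  have hflow := pureQuarticChain_measurable_chainFlow hμ hγ N
    (mΩ := MeasurableSpace.comap (pairPast s) inferInstance) (X := fun _ : WienerPair => x)
    measurable_const hGc hGm s
  -- the stopped noise drives the same flow on `[0, s]`
  have heq : (fun ω : WienerPair => (pureQuarticChain μ γ).solMap N T_L T_R s x (pairPath ω)) =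
      fun ω => (pureQuarticChain μ γ).chainFlow N x (G ω) s := by
    funext ω
    unfold OscillatorChain.solMap
    refine pureQuarticChain_chainFlow_congr hμ hγ N x (continuous_chainNoise _ _ _) (hGc ω)
      (fun u hu => ?_) ⟨s.coe_nonneg, le_rfl⟩
    simp only [hG, min_eq_left hu.2]
  rw [heq]
  exact hflow

/-- **The Chapman–Kolmogorov equation** `P_{s+t} = P_t ∘ P_s` for the transition kernels of the
purely quartic chain: the cocycle property of the pathwise flow through the shifted Brownian pair
(`pureQuarticChain_solMap_add_pairPath`), the measurability of `Φ_s(x, B)` with respect to the past, and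
the weak Markov property of the pair of independent Brownian motions
(`Literature.Probability.Process.lintegral_comp_pairShift_eq`: the shifted pair is independent of
the past and has the law of the pair). [cite: CuneoEckmannHairerReyBellet2018, §3 p. 7] -/
theorem pureQuarticChain_transitionKernel_add (s t : ℝ≥0) :
    (pureQuarticChain μ γ).transitionKernel N T_L T_R (s + t) =
      (pureQuarticChain μ γ).transitionKernel N T_L T_R t ∘ₖ
        (pureQuarticChain μ γ).transitionKernel N T_L T_R s := by
  classical
  refine Kernel.ext fun x => Measure.ext fun A hA => ?_
  -- the functional `G(y, w) = 1_A(Φ_t(y, w))` on `PhaseSpace × (raw pairs)`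
  set F : PhaseSpace N × WienerPair → PhaseSpace N := fun p =>
    (pureQuarticChain μ γ).solMap N T_L T_R t p.1 p.2 with hF
  have hFm : Measurable F := pureQuarticChain_measurable_solMap hμ hγ N T_L T_R t
  set G : PhaseSpace N × WienerPair → ℝ≥0∞ := (F ⁻¹' A).indicator 1 with hG
  have hGm : Measurable G := measurable_one.indicator (hFm hA)
  -- the past-measurable position at time `s`
  set ξ : WienerPair → PhaseSpace N := fun ω =>
    (pureQuarticChain μ γ).solMap N T_L T_R s x (pairPath ω) with hξ
  have hξF : Measurable[MeasurableSpace.comap (pairPast s) inferInstance] ξ :=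
    pureQuarticChain_measurable_comap_pairPast_solMap hμ hγ N T_L T_R s x
  -- left-hand side: the cocycle property
  have hL : (pureQuarticChain μ γ).transitionKernel N T_L T_R (s + t) x A =
      ∫⁻ ω, G (ξ ω, pairShift s ω) ∂wienerPair := by
    rw [pureQuarticChain_transitionKernel_apply' hμ hγ N T_L T_R (s + t) x hA,
      ← lintegral_indicator_one
        ((pureQuarticChain_measurable_solMap_pairPath_right hμ hγ N T_L T_R _ x) hA)]
    refine lintegral_congr fun ω => ?_
    simp only [hG, hF, hξ, Set.indicator_apply, Set.mem_preimage, NNReal.coe_add, Pi.one_apply]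
    rw [pureQuarticChain_solMap_add_pairPath hμ hγ N T_L T_R s t.coe_nonneg x ω]
  -- right-hand side: `∫ P_t(y, A) P_s(x, dy) = E[ E'[1_A(Φ_t(ξ, B'))] ]`
  have hR : ((pureQuarticChain μ γ).transitionKernel N T_L T_R t ∘ₖ
      (pureQuarticChain μ γ).transitionKernel N T_L T_R s) x A =
      ∫⁻ ω, ∫⁻ ω', G (ξ ω, pairPath ω') ∂wienerPair ∂wienerPair := by
    rw [Kernel.comp_apply' _ _ _ hA,
      pureQuarticChain_lintegral_transitionKernel hμ hγ N T_L T_R s x (Kernel.measurable_coe _ hA)]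
    refine lintegral_congr fun ω => ?_
    rw [pureQuarticChain_transitionKernel_apply' hμ hγ N T_L T_R t _ hA,
      ← lintegral_indicator_one
        ((pureQuarticChain_measurable_solMap_pairPath_right hμ hγ N T_L T_R _ _) hA)]
    refine lintegral_congr fun ω' => ?_
    simp only [hG, hF, hξ, Set.indicator_apply, Set.mem_preimage, Pi.one_apply]
  rw [hL, hR]
  exact lintegral_comp_pairShift_eq s hξF hGm

end ChapmanKolmogorov

/-! ### Two-sided energy bounds along the flow of the purely quartic chain -/

section PureQuartic

variable {μ γ : ℝ} (hμ : 0 < μ) (hγ : 0 ≤ γ) (N : ℕ)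
include hμ hγ

/-- **Lower linear energy bound**: `-DH(y)·Y(y + (0,e)) ≤ (C ‖e‖ + 4γ)(1 + H(y))` with
`C = pureQuarticEnergyConst`. [folklore] -/
theorem pureQuarticChain_neg_fderiv_hamiltonian_drift_le (y : PhaseSpace N) (e : Fin N → ℝ) :
    -(fderiv ℝ ((pureQuarticChain μ γ).hamiltonian N) y
        ((pureQuarticChain μ γ).drift N (y.1, y.2 + e))) ≤
      (pureQuarticEnergyConst μ γ N * ‖e‖ + 4 * γ) *
        (1 + (pureQuarticChain μ γ).hamiltonian N y) := by
  set P := pureQuarticChain μ γ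
  have hHd : Differentiable ℝ (P.hamiltonian N) :=
    (pureQuarticChain_contDiff_hamiltonian μ γ N).differentiable one_ne_zero
  have hγ' : 0 ≤ P.γ := hγ
  have h1 := P.neg_fderiv_hamiltonian_drift_le hHd hγ' y e
  have h2 := pureQuarticChain_linearEnergyBound hμ hγ N y
  have h3 := pureQuarticChain_sum_sq_le_two_mul_hamiltonian hμ.le γ N y
  have hH0 := pureQuarticChain_hamiltonian_nonneg hμ.le γ N y
  have h4 : ‖e‖ * ((∑ i, |partialQ i (P.hamiltonian N) y|) + 2 * P.γ * ∑ i, |y.2 i|) ≤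
      ‖e‖ * (pureQuarticEnergyConst μ γ N * (1 + P.hamiltonian N y)) :=
    mul_le_mul_of_nonneg_left h2 (norm_nonneg e)
  have h5 : 2 * P.γ * ∑ i, y.2 i ^ 2 ≤ 4 * γ * (1 + P.hamiltonian N y) := by
    show 2 * γ * ∑ i, y.2 i ^ 2 ≤ 4 * γ * (1 + P.hamiltonian N y)
    nlinarith [mul_le_mul_of_nonneg_left h3 hγ]
  calc -(fderiv ℝ (P.hamiltonian N) y (P.drift N (y.1, y.2 + e)))
      ≤ ‖e‖ * ((∑ i, |partialQ i (P.hamiltonian N) y|) + 2 * P.γ * ∑ i, |y.2 i|) +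
          2 * P.γ * ∑ i, y.2 i ^ 2 := h1
    _ ≤ ‖e‖ * (pureQuarticEnergyConst μ γ N * (1 + P.hamiltonian N y)) +
          4 * γ * (1 + P.hamiltonian N y) := add_le_add h4 h5
    _ = _ := by ring

/-- **The energy is at most exponentially DEcreasing along the flow**: for the flow
`z = chainFlow x η` of the purely quartic chain driven by a continuous noise path with `‖η‖ ≤ M` on
`[0, T]` and `y = z - (0, η)` its differentiable part,
`(1 + H(x)) e^{-(C M + 4γ) t} ≤ 1 + H(y(t))` on `[0, T]` (Grönwall for `-(1 + H∘y)`, whose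
derivative is `-DH(y)·Y(y + (0,η)) ≤ (C‖η‖ + 4γ)(1 + H∘y)`). The companion upper bound
`1 + H(y(t)) ≤ (1 + H(x)) e^{C M t}` is `pureQuarticChain_hamiltonian_chainFlow_le`. [folklore] -/
theorem pureQuarticChain_le_hamiltonian_chainFlow (x : PhaseSpace N) {η : ℝ → Fin N → ℝ}
    (hη : Continuous η) {T M : ℝ} (hM : ∀ t ∈ Icc 0 T, ‖η t‖ ≤ M) :
    ∀ t ∈ Icc 0 T, (1 + (pureQuarticChain μ γ).hamiltonian N x) *
        Real.exp (-(pureQuarticEnergyConst μ γ N * M + 4 * γ) * t) ≤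
      1 + (pureQuarticChain μ γ).hamiltonian N
        ((pureQuarticChain μ γ).chainFlow N x η t - ((0 : Fin N → ℝ), η t)) := by
  intro t ht
  set P := pureQuarticChain μ γ with hP
  set H := P.hamiltonian N with hHdef
  set Y := P.drift N with hYdef
  set z := P.chainFlow N x η with hzdef
  set C := pureQuarticEnergyConst μ γ N with hCdef
  set Λ := C * M + 4 * γ with hΛ
  have hT : 0 ≤ T := ht.1.trans ht.2
  have hM0 : 0 ≤ M := (norm_nonneg _).trans (hM 0 ⟨le_rfl, hT⟩)
  have hC0 : 0 ≤ C := pureQuarticEnergyConst_nonneg hμ γ N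
  have hYc : Continuous Y := (pureQuarticChain_contDiff_drift μ γ N (n := 0)).continuous
  have hzc : Continuous z := pureQuarticChain_continuous_chainFlow hμ hγ N x hη
  have hz_eq : ∀ s ∈ Icc 0 T, z s = forcing x η s + ∫ r in (0 : ℝ)..s, Y (z r) :=
    pureQuarticChain_isIntegralSolutionOn_chainFlow hμ hγ N x hη T
  have hHs : ContDiff ℝ 1 H := pureQuarticChain_contDiff_hamiltonian μ γ N
  have hHd : Differentiable ℝ H := hHs.differentiable one_ne_zero
  -- `y(t) = x + ∫₀ᵗ Y(z)`, `y' = Y(z)`, `y = z - (0, η)` on `[0, T]`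
  set y : ℝ → PhaseSpace N := fun s => x + ∫ r in (0 : ℝ)..s, Y (z r) with hydef
  have hy_deriv : ∀ s, HasDerivAt y (Y (z s)) s := fun s => by
    have h1 : HasDerivAt (fun u => ∫ r in (0 : ℝ)..u, Y (z r)) (Y (z s)) s :=
      ((hYc.comp hzc).integral_hasStrictDerivAt 0 s).hasDerivAt
    exact h1.const_add x
  have hy_eq : ∀ s ∈ Icc 0 T, y s = z s - ((0 : Fin N → ℝ), η s) := fun s hs => by
    rw [hz_eq s hs]
    simp only [hydef, forcing]
    abel
  have hz_y : ∀ s ∈ Icc 0 T, z s = ((y s).1, (y s).2 + η s) := fun s hs => by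
    rw [hy_eq s hs]; ext i <;> simp
  -- Grönwall for `f = -(1 + H∘y)`
  set f : ℝ → ℝ := fun s => -(1 + H (y s)) with hfdef
  have hf_deriv : ∀ s, HasDerivAt f (-(fderiv ℝ H (y s) (Y (z s)))) s := fun s =>
    (((hHd (y s)).hasFDerivAt.comp_hasDerivAt s (hy_deriv s)).const_add 1).neg
  have hf_cont : Continuous f := continuous_iff_continuousAt.2 fun s => (hf_deriv s).continuousAt
  have hbound : ∀ s ∈ Ico 0 T, -(fderiv ℝ H (y s) (Y (z s))) ≤ (-Λ) * f s + 0 := by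
    intro s hs
    have hs' : s ∈ Icc 0 T := ⟨hs.1, hs.2.le⟩
    rw [hz_y s hs']
    have h := pureQuarticChain_neg_fderiv_hamiltonian_drift_le hμ hγ N (y s) (η s)
    have hH0 : 0 ≤ H (y s) := pureQuarticChain_hamiltonian_nonneg hμ.le γ N (y s)
    have hηs : ‖η s‖ ≤ M := hM s hs'
    have hle : (C * ‖η s‖ + 4 * γ) * (1 + H (y s)) ≤ Λ * (1 + H (y s)) := by
      refine mul_le_mul_of_nonneg_right ?_ (by linarith)
      nlinarith [mul_le_mul_of_nonneg_left hηs hC0]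
    calc -(fderiv ℝ H (y s) (Y ((y s).1, (y s).2 + η s))) ≤ (C * ‖η s‖ + 4 * γ) * (1 + H (y s)) := h
      _ ≤ Λ * (1 + H (y s)) := hle
      _ = (-Λ) * f s + 0 := by simp only [hfdef]; ring
  have hf0 : f 0 ≤ -(1 + H x) := by simp [hfdef, hydef]
  have hG := le_gronwallBound_of_liminf_deriv_right_le (f := f)
    (f' := fun s => -(fderiv ℝ H (y s) (Y (z s)))) (δ := -(1 + H x)) (K := -Λ) (ε := 0) (a := 0)
    (b := T) hf_cont.continuousOn (fun s _ r hr => ?_) hf0 hbound t ht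
  · rw [sub_zero, gronwallBound_ε0] at hG
    have hfin : f t = -(1 + H (z t - ((0 : Fin N → ℝ), η t))) := by
      show -(1 + H (y t)) = _
      rw [hy_eq t ht]
    rw [hfin] at hG
    have : (1 + H x) * Real.exp (-Λ * t) ≤ 1 + H (z t - ((0 : Fin N → ℝ), η t)) := by linarith
    simpa [hΛ, hCdef] using this
  · have := ((hf_deriv s).hasDerivWithinAt (s := Ici s)).liminf_right_slope_le hr
    refine this.mono fun w hw => ?_
    rwa [slope_def_field, div_eq_inv_mul] at hw

/-- **The energy grows at most exponentially along the flow** (the bound of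
`pureQuarticChain_hamiltonian_truncSol_le`, transported to `chainFlow`):
`1 + H(z(t) - (0, η(t))) ≤ (1 + H(x)) e^{C M t}` on `[0, T]`. [cite: CuneoEckmannHairerReyBellet2018, §3 p. 7] -/
theorem pureQuarticChain_hamiltonian_chainFlow_le (x : PhaseSpace N) {η : ℝ → Fin N → ℝ}
    (hη : Continuous η) {T M : ℝ} (hM : ∀ t ∈ Icc 0 T, ‖η t‖ ≤ M) :
    ∀ t ∈ Icc 0 T, 1 + (pureQuarticChain μ γ).hamiltonian N
        ((pureQuarticChain μ γ).chainFlow N x η t - ((0 : Fin N → ℝ), η t)) ≤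
      (1 + (pureQuarticChain μ γ).hamiltonian N x) *
        Real.exp (pureQuarticEnergyConst μ γ N * M * t) := by
  intro t ht
  set R := max (pureQuarticRadius μ γ N ((pureQuarticChain μ γ).hamiltonian N x) M T) 1
  have hR : 0 < R := lt_max_of_lt_right one_pos
  rw [pureQuarticChain_chainFlow_eqOn_truncSol hμ hγ N hR x hη hM (le_max_left _ _) ht]
  exact pureQuarticChain_hamiltonian_truncSol_le hμ hγ N hR x hη hM t ht

end PureQuartic


/-! ### Local increment bounds and the far region -/

section Increments

variable {μ γ : ℝ} (hμ : 0 < μ) (hγ : 0 ≤ γ) (N : ℕ)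
include hμ hγ

omit hγ in
/-- The a-priori radius is monotone in all of `(E₀, M, T)` (`1 + E₀ ≥ 0`, `M, T ≥ 0`).
[folklore] -/
theorem pureQuarticRadius_mono₃ {E₀ E₀' M M' T T' : ℝ} (hE : 0 ≤ 1 + E₀) (hEE : E₀ ≤ E₀')
    (hM : 0 ≤ M) (hMM : M ≤ M') (hT : 0 ≤ T) (hTT : T ≤ T') :
    pureQuarticRadius μ γ N E₀ M T ≤ pureQuarticRadius μ γ N E₀' M' T' := by
  unfold pureQuarticRadius
  have hC := pureQuarticEnergyConst_nonneg hμ γ N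
  refine add_le_add (pureQuarticSublevelRadius_mono hμ ?_) hMM
  have h1 : Real.exp (pureQuarticEnergyConst μ γ N * M * T) ≤
      Real.exp (pureQuarticEnergyConst μ γ N * M' * T') :=
    Real.exp_le_exp.2 (mul_le_mul (mul_le_mul_of_nonneg_left hMM hC) hTT hT
      (mul_nonneg hC (hM.trans hMM)))
  have h2 := mul_le_mul (by linarith : 1 + E₀ ≤ 1 + E₀') h1 (Real.exp_pos _).le
    (by linarith : 0 ≤ 1 + E₀')
  linarith

/-- The flow increment without the noise is the time integral of the drift:
`z(t) - x - (0, η(t)) = ∫₀ᵗ Y(z(s)) ds` on `[0, T]`. [folklore] -/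
theorem pureQuarticChain_chainFlow_sub_sub_eq_integral (x : PhaseSpace N) {η : ℝ → Fin N → ℝ}
    (hη : Continuous η) {T t : ℝ} (ht : t ∈ Icc 0 T) :
    (pureQuarticChain μ γ).chainFlow N x η t - x - ((0 : Fin N → ℝ), η t) =
      ∫ s in (0 : ℝ)..t, (pureQuarticChain μ γ).drift N ((pureQuarticChain μ γ).chainFlow N x η s) := by
  rw [pureQuarticChain_isIntegralSolutionOn_chainFlow hμ hγ N x hη T t ht]
  simp only [forcing]
  abel

/-- **Local bounds for the flow started below an energy level.** For every level `E₀ ≥ 0` there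
are constants `R₀, Y₁, L₁ ≥ 0` such that for every start `x` with `H(x) ≤ E₀`, every continuous
noise path with `‖η‖ ≤ M ≤ 1` on `[0, T]`, `T ≤ 1`, and every `t ∈ [0, T]`: the flow stays in
the ball of radius `R₀`; the drift increment `D(t) = z(t) - x - (0, η(t))` has `‖D(t)‖ ≤ t Y₁`;
and `‖D(t) - t Y(x)‖ ≤ L₁ t (M + T Y₁)` (`Y₁` bounds the drift and `L₁` is its Lipschitz constant
on the ball). [folklore] -/
theorem pureQuarticChain_flow_local_bounds {E₀ : ℝ} (hE₀ : 0 ≤ E₀) :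
    ∃ R₀ Y₁ L₁ : ℝ, 0 ≤ R₀ ∧ 0 ≤ Y₁ ∧ 0 ≤ L₁ ∧
      ∀ x : PhaseSpace N, (pureQuarticChain μ γ).hamiltonian N x ≤ E₀ →
        ∀ {η : ℝ → Fin N → ℝ}, Continuous η → ∀ {T M : ℝ}, (∀ t ∈ Icc 0 T, ‖η t‖ ≤ M) →
          M ≤ 1 → T ≤ 1 → ∀ t ∈ Icc 0 T,
            ‖(pureQuarticChain μ γ).chainFlow N x η t‖ ≤ R₀ ∧
            ‖(pureQuarticChain μ γ).chainFlow N x η t - x - ((0 : Fin N → ℝ), η t)‖ ≤ t * Y₁ ∧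
            ‖(pureQuarticChain μ γ).chainFlow N x η t - x - ((0 : Fin N → ℝ), η t) -
                t • (pureQuarticChain μ γ).drift N x‖ ≤ L₁ * t * (M + T * Y₁) := by
  set P := pureQuarticChain μ γ with hP
  set R₀ := pureQuarticRadius μ γ N E₀ 1 1 with hR₀
  have hYc : ContDiff ℝ 1 (P.drift N) := pureQuarticChain_contDiff_drift μ γ N
  obtain ⟨Y₁', hY₁'⟩ := (isCompact_closedBall (0 : PhaseSpace N) R₀).exists_bound_of_continuousOn
    hYc.continuous.continuousOn
  set Y₁ := max Y₁' 0 with hY₁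
  obtain ⟨L₁, hL₁⟩ := exists_lipschitzOnWith_closedBall hYc R₀
  have hρ : ∀ {x : PhaseSpace N}, P.hamiltonian N x ≤ E₀ → ‖x‖ ≤ R₀ := fun {x} hx => by
    refine (pureQuarticChain_norm_le_sublevelRadius hμ γ N hx).trans ?_
    rw [hR₀, pureQuarticRadius]
    refine le_add_of_le_of_nonneg (pureQuarticSublevelRadius_mono hμ ?_) zero_le_one
    have hC := pureQuarticEnergyConst_nonneg hμ γ N
    have : 1 ≤ Real.exp (pureQuarticEnergyConst μ γ N * 1 * 1) := Real.one_le_exp (by simpa)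
    nlinarith
  have hR₀0 : 0 ≤ R₀ := add_nonneg (pureQuarticSublevelRadius_nonneg _ _) zero_le_one
  refine ⟨R₀, Y₁, L₁, hR₀0, le_max_right _ _, L₁.2, fun x hx η hη T M hM hM1 hT1 t ht => ?_⟩
  have hT : 0 ≤ T := ht.1.trans ht.2
  have hM0 : 0 ≤ M := (norm_nonneg _).trans (hM 0 ⟨le_rfl, hT⟩)
  -- the flow stays in the ball of radius `R₀`
  have hball : ∀ s ∈ Icc 0 T, ‖P.chainFlow N x η s‖ ≤ R₀ := fun s hs =>
    (pureQuarticChain_norm_chainFlow_le hμ hγ N x hη hM s hs).trans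
      (pureQuarticRadius_mono₃ hμ N (by linarith [pureQuarticChain_hamiltonian_nonneg hμ.le γ N x])
        hx hM0 hM1 hT hT1)
  have hYb : ∀ s ∈ Icc 0 T, ‖P.drift N (P.chainFlow N x η s)‖ ≤ Y₁ := fun s hs =>
    (hY₁' _ (mem_closedBall_zero_iff.2 (hball s hs))).trans (le_max_left _ _)
  have hcont : Continuous fun s => P.drift N (P.chainFlow N x η s) :=
    hYc.continuous.comp (pureQuarticChain_continuous_chainFlow hμ hγ N x hη)
  have hD : P.chainFlow N x η t - x - ((0 : Fin N → ℝ), η t) =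
      ∫ s in (0 : ℝ)..t, P.drift N (P.chainFlow N x η s) :=
    pureQuarticChain_chainFlow_sub_sub_eq_integral hμ hγ N x hη ht
  have hDs : ∀ s ∈ Icc 0 T, ‖P.chainFlow N x η s - x - ((0 : Fin N → ℝ), η s)‖ ≤ s * Y₁ := by
    intro s hs
    rw [pureQuarticChain_chainFlow_sub_sub_eq_integral hμ hγ N x hη hs]
    have h := intervalIntegral.norm_integral_le_of_norm_le_const (a := 0) (b := s) (C := Y₁)
      (f := fun r => P.drift N (P.chainFlow N x η r)) fun r hr => ?_
    · calc ‖∫ r in (0 : ℝ)..s, P.drift N (P.chainFlow N x η r)‖ ≤ Y₁ * |s - 0| := h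
        _ = s * Y₁ := by rw [sub_zero, abs_of_nonneg hs.1, mul_comm]
    · rw [uIoc_of_le hs.1] at hr
      exact hYb r ⟨hr.1.le, hr.2.trans hs.2⟩
  refine ⟨hball t ht, hDs t ht, ?_⟩
  -- `D(t) - t Y(x) = ∫₀ᵗ (Y(z(s)) - Y(x)) ds`, `‖Y(z(s)) - Y(x)‖ ≤ L₁ (M + T Y₁)`
  have hx0 : ‖x‖ ≤ R₀ := hρ hx
  have hdiff : ∀ s ∈ Icc 0 T, ‖P.drift N (P.chainFlow N x η s) - P.drift N x‖ ≤ L₁ * (M + T * Y₁) := by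
    intro s hs
    have h1 := hL₁.norm_sub_le (mem_closedBall_zero_iff.2 (hball s hs)) (mem_closedBall_zero_iff.2 hx0)
    refine h1.trans (mul_le_mul_of_nonneg_left ?_ L₁.2)
    calc ‖P.chainFlow N x η s - x‖
        = ‖(P.chainFlow N x η s - x - ((0 : Fin N → ℝ), η s)) + ((0 : Fin N → ℝ), η s)‖ := by
          rw [sub_add_cancel]
      _ ≤ ‖P.chainFlow N x η s - x - ((0 : Fin N → ℝ), η s)‖ + ‖((0 : Fin N → ℝ), η s)‖ :=
          norm_add_le _ _
      _ ≤ s * Y₁ + M := add_le_add (hDs s hs) (by rw [Prod.norm_def]; simp [hM s hs])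
      _ ≤ M + T * Y₁ := by nlinarith [hs.2, le_max_right Y₁' 0]
  have heq : P.chainFlow N x η t - x - ((0 : Fin N → ℝ), η t) - t • P.drift N x =
      ∫ s in (0 : ℝ)..t, (P.drift N (P.chainFlow N x η s) - P.drift N x) := by
    rw [hD, intervalIntegral.integral_sub (hcont.intervalIntegrable _ _) intervalIntegrable_const,
      intervalIntegral.integral_const, sub_zero]
  rw [heq]
  have h := intervalIntegral.norm_integral_le_of_norm_le_const (a := 0) (b := t) (C := L₁ * (M + T * Y₁))
    (f := fun s => P.drift N (P.chainFlow N x η s) - P.drift N x) fun s hs => ?_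
  · calc ‖∫ s in (0 : ℝ)..t, (P.drift N (P.chainFlow N x η s) - P.drift N x)‖
        ≤ L₁ * (M + T * Y₁) * |t - 0| := h
      _ = L₁ * t * (M + T * Y₁) := by rw [sub_zero, abs_of_nonneg ht.1]; ring
  · rw [uIoc_of_le ht.1] at hs
    exact hdiff s ⟨hs.1.le, hs.2.trans ht.2⟩

/-- **The far region.** For every energy level `E_K` there is a level `E₁` such that the flow
started at `H(x) > E₁` and driven by a continuous noise path with `‖η‖ ≤ M ≤ 1/2` on `[0, T]`,
`T ≤ 1`, stays STRICTLY ABOVE the level `E_K` on `[0, T]` (the energy decreases at most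
exponentially, `pureQuarticChain_le_hamiltonian_chainFlow`, and adding back the noise momentum costs at
most `M(N/2 + H)`). [folklore] -/
theorem pureQuarticChain_flow_far (E_K : ℝ) :
    ∃ E₁ : ℝ, 0 ≤ E₁ ∧ ∀ x : PhaseSpace N, E₁ < (pureQuarticChain μ γ).hamiltonian N x →
      ∀ {η : ℝ → Fin N → ℝ}, Continuous η → ∀ {T M : ℝ}, (∀ t ∈ Icc 0 T, ‖η t‖ ≤ M) →
        M ≤ 1 / 2 → T ≤ 1 → ∀ t ∈ Icc 0 T,
          E_K < (pureQuarticChain μ γ).hamiltonian N ((pureQuarticChain μ γ).chainFlow N x η t) := by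
  set P := pureQuarticChain μ γ with hP
  set C := pureQuarticEnergyConst μ γ N with hC
  set Λ₀ := C / 2 + 4 * γ with hΛ₀
  have hC0 : 0 ≤ C := pureQuarticEnergyConst_nonneg hμ γ N
  set E₁ := max 0 ((2 * |E_K| + N / 2 + 1) * Real.exp Λ₀) with hE₁
  refine ⟨E₁, le_max_left _ _, fun x hx η hη T M hM hM2 hT1 t ht => ?_⟩
  have hT : 0 ≤ T := ht.1.trans ht.2
  have hM0 : 0 ≤ M := (norm_nonneg _).trans (hM 0 ⟨le_rfl, hT⟩)
  set y := P.chainFlow N x η t - ((0 : Fin N → ℝ), η t) with hy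
  have hz : P.chainFlow N x η t = (y.1, y.2 + η t) := by ext i <;> simp [hy]
  -- lower energy bound along the differentiable part
  have hlow := pureQuarticChain_le_hamiltonian_chainFlow hμ hγ N x hη hM t ht
  have hexp : Real.exp (-Λ₀) ≤ Real.exp (-(C * M + 4 * γ) * t) := by
    refine Real.exp_le_exp.2 ?_
    have h1 : (C * M + 4 * γ) * t ≤ Λ₀ := by
      have : C * M + 4 * γ ≤ Λ₀ := by rw [hΛ₀]; nlinarith
      calc (C * M + 4 * γ) * t ≤ (C * M + 4 * γ) * 1 :=
            mul_le_mul_of_nonneg_left (ht.2.trans hT1) (by positivity)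
        _ ≤ Λ₀ := by linarith
    linarith
  have hHx := pureQuarticChain_hamiltonian_nonneg hμ.le γ N x
  have hHy := pureQuarticChain_hamiltonian_nonneg hμ.le γ N y
  have h1 : (1 + P.hamiltonian N x) * Real.exp (-Λ₀) ≤ 1 + P.hamiltonian N y :=
    (mul_le_mul_of_nonneg_left hexp (by linarith)).trans hlow
  -- adding back the noise momentum
  have h2 : P.hamiltonian N y - M * (N / 2 + P.hamiltonian N y) ≤ P.hamiltonian N (P.chainFlow N x η t) := by
    rw [hz]
    refine le_trans ?_ (P.hamiltonian_sub_le_hamiltonian_add_momentum N y (η t))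
    have hs := pureQuarticChain_sum_abs_momentum_le hμ.le γ N y
    nlinarith [mul_le_mul (hM t ht) hs (Finset.sum_nonneg fun i _ => abs_nonneg (y.2 i)) hM0]
  -- `E₁ < H(x)` and the choice of `E₁`
  have h3 : (2 * |E_K| + N / 2 + 1) * Real.exp Λ₀ < P.hamiltonian N x := (le_max_right _ _).trans_lt hx
  have h4 : 2 * |E_K| + N / 2 + 1 < (1 + P.hamiltonian N x) * Real.exp (-Λ₀) := by
    rw [Real.exp_neg]
    rw [lt_mul_inv_iff₀ (Real.exp_pos Λ₀)]
    nlinarith [Real.exp_pos Λ₀]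
  have hEK : E_K ≤ |E_K| := le_abs_self _
  have h5 : M * (N / 2 + P.hamiltonian N y) ≤ 1 / 2 * (N / 2 + P.hamiltonian N y) :=
    mul_le_mul_of_nonneg_right hM2 (by positivity)
  linarith

end Increments

section NoiseContinuity

variable {μ γ : ℝ}

/-- **The flow of the purely quartic chain is Lipschitz in the noise path** (uniform norm on `[0, T]`):
for `μ > 0`, `γ ≥ 0`, an initial condition `x`, continuous noise paths `η₁, η₂` with
`‖ηᵢ(t)‖ ≤ M` and `‖η₁(t) - η₂(t)‖ ≤ δ` on `[0, T]`, and every truncation radius `R` beyond the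
a-priori radius `R₀(H(x), M, T)` with Lipschitz constant `K` of the truncated drift,
`‖z_{x,η₁}(t) - z_{x,η₂}(t)‖ ≤ δ e^{Kt}` for `t ∈ [0, T]`. [folklore] -/
theorem pureQuarticChain_norm_chainFlow_sub_chainFlow_le (hμ : 0 < μ)
    (hγ : 0 ≤ γ) (N : ℕ) (x : PhaseSpace N) {η₁ η₂ : ℝ → Fin N → ℝ} (hη₁ : Continuous η₁)
    (hη₂ : Continuous η₂) {T M δ : ℝ} (hM₁ : ∀ t ∈ Icc 0 T, ‖η₁ t‖ ≤ M)
    (hM₂ : ∀ t ∈ Icc 0 T, ‖η₂ t‖ ≤ M) (hδ : ∀ t ∈ Icc 0 T, ‖η₁ t - η₂ t‖ ≤ δ)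
    {R : ℝ} (hR : 0 < R)
    (hRR : pureQuarticRadius μ γ N ((pureQuarticChain μ γ).hamiltonian N x) M T ≤ R)
    {K : ℝ≥0} (hK : LipschitzWith K (truncateField R ((pureQuarticChain μ γ).drift N))) :
    ∀ t ∈ Icc 0 T, ‖(pureQuarticChain μ γ).chainFlow N x η₁ t -
        (pureQuarticChain μ γ).chainFlow N x η₂ t‖ ≤ δ * Real.exp (K * t) := by
  intro t ht
  rw [pureQuarticChain_chainFlow_eqOn_truncSol hμ hγ N hR x hη₁ hM₁ hRR ht,
    pureQuarticChain_chainFlow_eqOn_truncSol hμ hγ N hR x hη₂ hM₂ hRR ht]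
  unfold OscillatorChain.truncSol
  refine Literature.Analysis.ODE.norm_forcedSolution_sub_le hK (continuous_forcing x hη₁)
    (continuous_forcing x hη₂) (fun s hs => ?_) t ht
  have h : forcing x η₁ s - forcing x η₂ s = ((0 : Fin N → ℝ), η₁ s - η₂ s) := by
    simp only [forcing]
    ext i <;> simp
  rw [h, Prod.norm_def]
  simpa using hδ s hs

/-- **Continuity of the flow in the noise path, `ε`-`δ` form, uniform on bounded sets**: for
`E₀, M, T` and `ε > 0` there is `δ > 0` such that for every initial condition with `H(x) ≤ E₀`
and all continuous noise paths `η₁, η₂` bounded by `M` on `[0, T]` with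
`sup_{[0,T]} ‖η₁ - η₂‖ ≤ δ`, one has `‖z_{x,η₁}(t) - z_{x,η₂}(t)‖ < ε` on `[0, T]`. [folklore] -/
theorem pureQuarticChain_exists_norm_chainFlow_sub_lt (hμ : 0 < μ)
    (hγ : 0 ≤ γ) (N : ℕ) (E₀ M T : ℝ) {ε : ℝ} (hε : 0 < ε) :
    ∃ δ : ℝ, 0 < δ ∧ ∀ (x : PhaseSpace N), (pureQuarticChain μ γ).hamiltonian N x ≤ E₀ →
      ∀ (η₁ η₂ : ℝ → Fin N → ℝ), Continuous η₁ → Continuous η₂ →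
        (∀ t ∈ Icc 0 T, ‖η₁ t‖ ≤ M) → (∀ t ∈ Icc 0 T, ‖η₂ t‖ ≤ M) →
        (∀ t ∈ Icc 0 T, ‖η₁ t - η₂ t‖ ≤ δ) →
        ∀ t ∈ Icc 0 T, ‖(pureQuarticChain μ γ).chainFlow N x η₁ t -
          (pureQuarticChain μ γ).chainFlow N x η₂ t‖ < ε := by
  -- one truncation radius for all initial conditions of energy `≤ E₀`
  set R : ℝ := max (pureQuarticRadius μ γ N E₀ M T) 1 with hRdef
  have hR : 0 < R := lt_max_of_lt_right one_pos
  obtain ⟨K, hK⟩ := pureQuarticChain_exists_lipschitzWith_truncDrift μ γ N hR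
  -- `δ e^{K max(T,0)} < ε`
  set L : ℝ := Real.exp (K * max T 0) with hL
  have hL0 : 0 < L := Real.exp_pos _
  refine ⟨ε / (2 * L), by positivity, fun x hx η₁ η₂ hη₁ hη₂ hM₁ hM₂ hδ t ht => ?_⟩
  have hRR : pureQuarticRadius μ γ N ((pureQuarticChain μ γ).hamiltonian N x) M T ≤ R :=
    (pureQuarticRadius_mono hμ N hx).trans (le_max_left _ _)
  have h := pureQuarticChain_norm_chainFlow_sub_chainFlow_le hμ hγ N x hη₁ hη₂ hM₁ hM₂ hδ hR hRR
    hK t ht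
  have hexp : Real.exp (K * t) ≤ L := by
    rw [hL]
    exact Real.exp_le_exp.2 (mul_le_mul_of_nonneg_left (le_max_of_le_left ht.2) K.coe_nonneg)
  calc ‖(pureQuarticChain μ γ).chainFlow N x η₁ t - (pureQuarticChain μ γ).chainFlow N x η₂ t‖
      ≤ ε / (2 * L) * Real.exp (K * t) := h
    _ ≤ ε / (2 * L) * L := mul_le_mul_of_nonneg_left hexp (by positivity)
    _ = ε / 2 := by field_simp
    _ < ε := half_lt_self hε

end NoiseContinuity

end Literature.MathematicalPhysics.KineticTheory.HeatConduction
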